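import Summits.QuantumFields.YangMills.Theorems.BalabanUVNodesN08HaarCompatibilityGuardHaarBall
import Summits.QuantumFields.YangMills.Theorems.BalabanUVNodesN08HaarCompatibilityGuardKStepMassesSU2Record
import Literature.MathematicalPhysics.QuantumFieldTheory.Balaban1983to89.T4ExpWindowSmallField

/-!
# BalabanUVNodes ∕ N08 — THE HAAR MEASURE OF A SMALL BALL OF `SU(2)` FROM BELOW, AND THE ONE-STEP DENSITY AT THE RECORD'S BLOCK SIZES AS A NUMBER:
# `Ū_*(dU_j) ≤ (1 + 4.2·10¹⁰·4^{1−L^{d−1}})^{#PBond(j+1)} • dU_{j+1}` — per coarse bond within `10⁻²⁷` of `1` at `L = 8` (item 3, part 33)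

WIDTH SEAT `pub-ymgap-dag-n08-w3` g6, item-3 lineage (g4's `N08-ONE-STEP-BOUND-NEXT.md` §3 (a): «a LOWER bound for `h(1∕3)` needs the exp-chart Jacobian from below»),
2026-08-28.  DAG node N08 = [Balaban1985UV3] Thm 1 p. 257 + Thm 2 p. 272, (2) p. 256, p. 260 (the `SU(2)` Haar density `σ(A) = (2π²)⁻¹(sin|A|∕|A|)²`); the typed
(0.4) averaging = [Balaban1987RG1] (0.4) p. 253; key item K1⁷ `StabilityBAtRecordR13SepCoPH` (stmt-QuantumFields-20542, `aside`), `--supports … --as helper`.  COUNT-NEUTRAL.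

WHAT THIS FILE PROVES (theorems only, 0 def; over part 10 `…GuardHaarBall` (the UPPER bound `h(δ) ≤ π²δ³∕12`), pub-balaban's exponential chart
`lintegral_haarProbability_su2_exp` and part 32 `…GuardKStepMassesSU2Record` BY IMPORT):
 §1 ★ `haar_dist1_lt_ge`: **`Haar_{SU(2)}{‖U − 1‖ < δ} ≥ (2∕3π)(1 − δ²∕6)²δ³`** for `0 ≤ δ ≤ 1` (the Euclidean ball of radius `δ` maps INTO the `dist1`-ball —
    `dist1_expPoint_le`, chord ≤ arc — and `sinc² ≥ (1 − δ²∕6)²` there) · `haar_dist1_lt_third_ge` (`h(1∕3) ≥ 1∕140`) · `haar_dist1_lt_twoThirds_le` (`h(2∕3) ≤ 1∕4`).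
 §2 ★★ `density_third_le`: at `δ′ = 1∕3` the one-step density constant of parts 23∕28∕32, `D = h(1∕3)^{−n}(h(1∕3) + (K − 1)h(2∕3)^{M})^{n}` (`K ≤ 3·10⁸` by part 32's
    `kstar_record_le`, `M = L^{d−1} − 1`, `n = #PBond(j+1)`), satisfies **`D ≤ (1 + 140·(3·10⁸ − 1)·4^{−M})^{n}`** — a CLOSED NUMBER; `numeric_L8`: at `L = 8`, `d = 3`
    the per-bond excess `140·(3·10⁸ − 1)·4^{−63} ≤ 10^{−27}`.
 §3 ★★★ `map_avOfPrint_le_smul_su2_record_third`: **`(avOfPrint 2)_{j*}(dU_j) ≤ (1 + 140·(3·10⁸ − 1)·4^{1−L^{d−1}})^{#PBond(j+1)} • dU_{j+1}`** on `L^{d−1} ≤ 400`, NO (H_K)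
    hypothesis; ★★ `TOfPrint_one_le_ae_su2_record_third`: print's RN version `T1 ≤` the same number, a.e.

HONEST FRAMING.  Count-neutral [folklore] measure bookkeeping BY IMPORT; one RG step; the bound is extensive in `#PBond(j+1)` (stacking across levels NOT controlled — the
k-uniform `hmass` is NOT supplied); E6′ NOT decided; nothing of Bałaban's asserted; N08 NOT discharged; counts unmoved (typed 28∕28 · discharged 5∕27); one finite 𝕋⁴
programme at fixed ε — R4 closes the CONDITIONAL rung `BalabanLadder.UV` only; the Yang–Mills mass gap (Clay) is NOT proved; nothing continuum ∕ OS.  0 `sorry`,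
0 `def`, 0 `instance`, 0 `notation`, standard axioms.
-/

noncomputable section

open MeasureTheory Metric Set Function
open scoped ENNReal

namespace Summit.QuantumFields.YangMills.BalabanUVNodes.N08HaarCompatibilityGuardHaarBallLower

open Literature.MathematicalPhysics.QuantumFieldTheory.Balaban1983to89
open Literature.MathematicalPhysics.QuantumFieldTheory (haarProbability)
open Literature.MathematicalPhysics.QuantumFieldTheory.Balaban1983to89.T4CubeChartGnomonic (SU2)
open Literature.MathematicalPhysics.QuantumFieldTheory.Balaban1983to89.T4HaarSU2ExpChart
open Literature.MathematicalPhysics.QuantumFieldTheory.Balaban1983to89.T4ExpWindowSmallField (dist1_expPoint_le)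
open Summit.QuantumFields.YangMills.BalabanUVNodes.N08HaarCompatibilityGuardHaarBall (volume_ball_three haar_dist1_lt_le haarData_haar_eq min_third_pi_div_two)

/-! ## §1 The Haar measure of a small ball from below -/

section Ball

/-- ★ **`Haar_{SU(2)}{U | ‖U − 1‖ < δ} ≥ (2∕3π)·(1 − δ²∕6)²·δ³`** for `0 ≤ δ ≤ 1`: in pub-balaban's exponential chart (`lintegral_haarProbability_su2_exp`, density
`(2π²)⁻¹ sinc²`), the Euclidean ball of radius `δ` is carried INTO the `dist1`-ball (`dist1 (exp ιx) ≤ ‖x‖`, chord ≤ arc) and `sinc ‖x‖ ≥ 1 − ‖x‖²∕6 ≥ 1 − δ²∕6`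
there; `vol B_{ℝ³}(0, δ) = (4∕3)πδ³`. [cite: Balaban1985UV3, p.260 (the SU(2) Haar density; bookkeeping)] -/
theorem haar_dist1_lt_ge {δ : ℝ} (hδ0 : 0 ≤ δ) (hδ1 : δ ≤ 1) :
    ENNReal.ofReal (2 / (3 * Real.pi) * ((1 - δ ^ 2 / 6) ^ 2 * δ ^ 3)) ≤ haarProbability SU2 {U : SU2 | dist1 U < δ} := by
  have hmeas : MeasurableSet {U : SU2 | dist1 U < δ} := measurableSet_lt RegularGaugeGroup.measurable_dist1 measurable_const
  have hπ := Real.pi_pos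
  rw [← lintegral_indicator_one hmeas, lintegral_haarProbability_su2_exp _ (measurable_one.indicator hmeas)]
  have hG : Measurable fun x : EuclideanSpace ℝ (Fin 3) =>
      ({U : SU2 | dist1 U < δ}.indicator 1 (expPoint x)) * ENNReal.ofReal (Real.sinc ‖x‖ ^ 2) :=
    ((measurable_one.indicator hmeas).comp measurable_expPoint).mul
      ((Real.continuous_sinc.comp continuous_norm).pow 2).measurable.ennreal_ofReal
  -- the constant lower bound on the Euclidean ball of radius `δ`
  have hpt : ∀ x ∈ ball (0 : EuclideanSpace ℝ (Fin 3)) δ,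
      ENNReal.ofReal ((1 - δ ^ 2 / 6) ^ 2) ≤ ({U : SU2 | dist1 U < δ}.indicator 1 (expPoint x)) * ENNReal.ofReal (Real.sinc ‖x‖ ^ 2) := by
    intro x hx
    have hxδ : ‖x‖ < δ := mem_ball_zero_iff.1 hx
    have hmem : expPoint x ∈ {U : SU2 | dist1 U < δ} := (dist1_expPoint_le x).trans_lt hxδ
    rw [indicator_of_mem hmem, Pi.one_apply, one_mul]
    refine ENNReal.ofReal_le_ofReal ?_
    have hsinc : 1 - ‖x‖ ^ 2 / 6 ≤ Real.sinc ‖x‖ := by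
      rcases eq_or_lt_of_le (norm_nonneg x) with h0 | h0
      · rw [← h0, Real.sinc_zero]; norm_num
      · rw [Real.sinc_of_ne_zero h0.ne', le_div_iff₀ h0]
        nlinarith [Real.sin_ge_sub_cube h0.le]
    have h1 : 1 - δ ^ 2 / 6 ≤ 1 - ‖x‖ ^ 2 / 6 := by nlinarith [norm_nonneg x]
    have h2 : 0 ≤ 1 - δ ^ 2 / 6 := by nlinarith
    exact pow_le_pow_left₀ h2 (h1.trans hsinc) 2
  have hball : ball (0 : EuclideanSpace ℝ (Fin 3)) δ ⊆ ball (0 : EuclideanSpace ℝ (Fin 3)) Real.pi :=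
    ball_subset_ball (by linarith [Real.pi_gt_three])
  calc ENNReal.ofReal (2 / (3 * Real.pi) * ((1 - δ ^ 2 / 6) ^ 2 * δ ^ 3))
      = ENNReal.ofReal (1 / (2 * Real.pi ^ 2)) * (ENNReal.ofReal ((1 - δ ^ 2 / 6) ^ 2) * volume (ball (0 : EuclideanSpace ℝ (Fin 3)) δ)) := by
        rw [volume_ball_three hδ0, ← ENNReal.ofReal_mul (sq_nonneg _), ← ENNReal.ofReal_mul (by positivity)]
        congr 1
        field_simp
        ring
    _ ≤ ENNReal.ofReal (1 / (2 * Real.pi ^ 2)) *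
          ∫⁻ x in ball (0 : EuclideanSpace ℝ (Fin 3)) Real.pi, ({U : SU2 | dist1 U < δ}.indicator 1 (expPoint x)) * ENNReal.ofReal (Real.sinc ‖x‖ ^ 2) := by
        gcongr
        calc ENNReal.ofReal ((1 - δ ^ 2 / 6) ^ 2) * volume (ball (0 : EuclideanSpace ℝ (Fin 3)) δ)
            = ∫⁻ _ in ball (0 : EuclideanSpace ℝ (Fin 3)) δ, ENNReal.ofReal ((1 - δ ^ 2 / 6) ^ 2) := by rw [setLIntegral_const]
          _ ≤ ∫⁻ x in ball (0 : EuclideanSpace ℝ (Fin 3)) δ, ({U : SU2 | dist1 U < δ}.indicator 1 (expPoint x)) * ENNReal.ofReal (Real.sinc ‖x‖ ^ 2) :=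
              setLIntegral_mono hG hpt
          _ ≤ ∫⁻ x in ball (0 : EuclideanSpace ℝ (Fin 3)) Real.pi, ({U : SU2 | dist1 U < δ}.indicator 1 (expPoint x)) * ENNReal.ofReal (Real.sinc ‖x‖ ^ 2) :=
              lintegral_mono_set hball

/-- **`Haar_{SU(2)}{‖U − 1‖ < 1∕3} ≥ 1∕140`** (the radius of the printed exp-mean-log's domain at `N = 2`; `π ≤ 3.1416`). [cite: Balaban1987RG1, (0.4) p.253 (bookkeeping)] -/
theorem haar_dist1_lt_third_ge : (140 : ℝ≥0∞)⁻¹ ≤ haarProbability SU2 {U : SU2 | dist1 U < 1 / 3} := by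
  have hπ := Real.pi_pos
  have hπ4 : Real.pi < 3.1416 := Real.pi_lt_d4
  have hle : (1 / 140 : ℝ) ≤ 2 / (3 * Real.pi) * ((1 - (1 / 3 : ℝ) ^ 2 / 6) ^ 2 * (1 / 3 : ℝ) ^ 3) := by
    rw [div_mul_eq_mul_div, le_div_iff₀ (by positivity)]
    nlinarith
  calc (140 : ℝ≥0∞)⁻¹ = ENNReal.ofReal (1 / 140 : ℝ) := by rw [one_div, ENNReal.ofReal_inv_of_pos (by norm_num)]; norm_num
    _ ≤ ENNReal.ofReal (2 / (3 * Real.pi) * ((1 - (1 / 3 : ℝ) ^ 2 / 6) ^ 2 * (1 / 3 : ℝ) ^ 3)) := ENNReal.ofReal_le_ofReal hle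
    _ ≤ haarProbability SU2 {U : SU2 | dist1 U < 1 / 3} := haar_dist1_lt_ge (by norm_num) (by norm_num)

/-- **`Haar_{SU(2)}{‖U − 1‖ < 2∕3} ≤ 1∕4`** (part 10's `π²δ³∕12` at `δ = 2∕3`: `2π²∕81 ≤ 1∕4`). [cite: Balaban1985UV3, p.260 (bookkeeping)] -/
theorem haar_dist1_lt_twoThirds_le : haarProbability SU2 {U : SU2 | dist1 U < 2 / 3} ≤ (4 : ℝ≥0∞)⁻¹ := by
  have hπ := Real.pi_lt_d2
  have hπ0 := Real.pi_pos
  calc haarProbability SU2 {U : SU2 | dist1 U < 2 / 3} ≤ ENNReal.ofReal (Real.pi ^ 2 * (2 / 3 : ℝ) ^ 3 / 12) := haar_dist1_lt_le (by norm_num) (by norm_num)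
    _ ≤ ENNReal.ofReal (1 / 4 : ℝ) := ENNReal.ofReal_le_ofReal (by nlinarith)
    _ = (4 : ℝ≥0∞)⁻¹ := by rw [one_div, ENNReal.ofReal_inv_of_pos (by norm_num)]; norm_num

end Ball

/-! ## §2 The one-step density constant at `δ′ = 1∕3` as a closed number -/

section Density

open Literature.MathematicalPhysics.QuantumFieldTheory.Balaban1983to89.Node00 (SU)

/-- ★★ **THE DENSITY CONSTANT IS A NUMBER**: for the slot's Haar datum on `SU(2)`, any `K ≤ 3·10⁸` in `ℝ≥0∞` and all `M, n : ℕ`,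
`h(1∕3)^{−n}·(h(1∕3) + (K − 1)·h(min(1∕3, π∕2) + 1∕3)^{M})^{n} ≤ (1 + 140·(3·10⁸ − 1)·4^{−M})^{n}` (`h(1∕3) ≥ 1∕140`, `h(2∕3) ≤ 1∕4` from §1).
[cite: Balaban1985UV3, p.260 (bookkeeping)] -/
theorem density_third_le {K : ℝ≥0∞} (hK : K ≤ 300000000) (M n : ℕ) :
    (((HaarData.haar : Measure (SU 2)) {g : SU 2 | dist1 g < 1 / 3} ^ n)⁻¹ *
        ((HaarData.haar : Measure (SU 2)) {g : SU 2 | dist1 g < 1 / 3} +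
            (K - 1) * (HaarData.haar : Measure (SU 2)) {g : SU 2 | dist1 g < min (1 / 3) (Real.pi / (2 : ℕ)) + 1 / 3} ^ M) ^ n) ≤
      (1 + 140 * ((300000000 - 1) * (4 : ℝ≥0∞)⁻¹ ^ M)) ^ n := by
  rw [haarData_haar_eq, min_third_pi_div_two, show (1 / 3 : ℝ) + 1 / 3 = 2 / 3 by norm_num]
  set h₁ : ℝ≥0∞ := haarProbability SU2 {g : SU2 | dist1 g < 1 / 3} with hh₁
  set h₂ : ℝ≥0∞ := haarProbability SU2 {g : SU2 | dist1 g < 2 / 3} with hh₂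
  have h1ge : (140 : ℝ≥0∞)⁻¹ ≤ h₁ := haar_dist1_lt_third_ge
  have h2le : h₂ ≤ (4 : ℝ≥0∞)⁻¹ := haar_dist1_lt_twoThirds_le
  have h10 : h₁ ≠ 0 := fun h0 => by
    rw [h0, nonpos_iff_eq_zero, ENNReal.inv_eq_zero] at h1ge
    exact absurd h1ge (by norm_num)
  haveI : IsProbabilityMeasure (haarProbability SU2) := HaarData.isProb (G := SU 2)
  have h1top : h₁ ≠ ⊤ := measure_ne_top _ _
  have hinv : h₁⁻¹ ≤ 140 := by
    have := ENNReal.inv_le_inv.2 h1ge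
    rwa [inv_inv] at this
  have hK1 : K - 1 ≤ 300000000 - 1 := tsub_le_tsub_right hK 1
  calc (h₁ ^ n)⁻¹ * (h₁ + (K - 1) * h₂ ^ M) ^ n = (h₁⁻¹ * (h₁ + (K - 1) * h₂ ^ M)) ^ n := by rw [ENNReal.inv_pow, ← mul_pow]
    _ = (1 + h₁⁻¹ * ((K - 1) * h₂ ^ M)) ^ n := by rw [mul_add, ENNReal.inv_mul_cancel h10 h1top]
    _ ≤ (1 + 140 * ((300000000 - 1) * (4 : ℝ≥0∞)⁻¹ ^ M)) ^ n := by gcongr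

/-- `numeric_L8`: at the record's smallest admissible block size `L = 8`, `d = 3` (`M = L² − 1 = 63`) the per-bond excess is below `10⁻²⁷`:
`140·(3·10⁸ − 1)·4⁻⁶³ ≤ 10⁻²⁷` (real numbers). [folklore] -/
theorem numeric_L8 : (140 : ℝ) * (300000000 - 1) * (1 / 4) ^ 63 ≤ (1 / 10) ^ 27 := by norm_num

end Density

/-! ## §3 The one-step transport bound at the slot, `N = 2`, `L^{d−1} ≤ 400`, as a closed number -/

section Slot

open Literature.MathematicalPhysics.QuantumFieldTheory.Balaban1983to89.Node00 (SU)
open Literature.MathematicalPhysics.QuantumFieldTheory.Balaban1985CMP102.Setting (Scales)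
open Literature.MathematicalPhysics.QuantumFieldTheory.Balaban1983to89.B10RunsOfRecord (avOfPrint TOfPrint)
open Summit.QuantumFields.YangMills.BalabanUVNodes.N08HaarCompatibilityGuardKStepMassesSU2Record
  (map_avOfPrint_le_smul_su2_record TOfPrint_one_le_ae_su2_record kstar_record_le)

variable {L : ℕ} (S : Scales L)

/-- ★★★ **THE ONE-STEP EXTENSIVE TRANSPORT BOUND AT THE [B10] SLOT AS A NUMBER** (`N = 2`, `L^{d−1} ≤ 400`, `j + 1 ≤ m + K`, NO (H_K) hypothesis):
`(avOfPrint 2)_{j*}(dU_j) ≤ (1 + 140·(3·10⁸ − 1)·4^{1−L^{d−1}})^{#PBond(j+1)} • dU_{j+1}` — part 32's `map_avOfPrint_le_smul_su2_record` at `δ′ = 1∕3` with §2.  At the record's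
`L = 8`, `d = 3` the per-bond factor is `≤ 1 + 10⁻²⁷` (`numeric_L8`).  HONEST: extensive in `#PBond(j+1)`; one RG step; NOT the k-uniform `hmass`.
[cite: Balaban1985UV3, (2) p.256, p.260; Balaban1987RG1, (0.4) p.253 (bookkeeping — the bound is NOT in print)] -/
theorem map_avOfPrint_le_smul_su2_record_third (hL : S.P.L ^ (S.P.d - 1) ≤ 400) {j : ℕ} (hj : j + 1 ≤ S.P.m + S.P.K) :
    (fieldMeasure S.P j (SU 2)).map (avOfPrint 2 S j).avg ≤
      (1 + 140 * ((300000000 - 1) * (4 : ℝ≥0∞)⁻¹ ^ (S.P.L ^ (S.P.d - 1) - 1))) ^ Fintype.card (PBond S.P (j + 1)) •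
        fieldMeasure S.P (j + 1) (SU 2) := by
  refine (map_avOfPrint_le_smul_su2_record S hL hj (δ' := 1 / 3) (by norm_num)).trans (Measure.le_iff'.2 fun t => ?_)
  rw [Measure.smul_apply, Measure.smul_apply, smul_eq_mul, smul_eq_mul]
  exact mul_le_mul' (density_third_le kstar_record_le _ _) le_rfl

/-- ★★ **PRINT'S ONE-STEP RN DENSITY AS A NUMBER: `T1 ≤ (1 + 140·(3·10⁸ − 1)·4^{1−L^{d−1}})^{#PBond(j+1)}` a.e.** (`N = 2`, `L^{d−1} ≤ 400`, NO (H_K) hypothesis) —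
part 32's `TOfPrint_one_le_ae_su2_record` at `δ′ = 1∕3` with §2 (n08-w1's density currency `ρ_j = T1`).
[cite: Balaban1985UV3, (2) p.256; Balaban1985Averaging, (10) p.19 (bookkeeping — no bound of print is asserted)] -/
theorem TOfPrint_one_le_ae_su2_record_third (hL : S.P.L ^ (S.P.d - 1) ≤ 400) {j : ℕ} (hj : j + 1 ≤ S.P.m + S.P.K) :
    ∀ᵐ V ∂(fieldMeasure S.P (j + 1) (SU 2)), ENNReal.ofReal ((TOfPrint 2 S j).T 1 V) ≤
      (1 + 140 * ((300000000 - 1) * (4 : ℝ≥0∞)⁻¹ ^ (S.P.L ^ (S.P.d - 1) - 1))) ^ Fintype.card (PBond S.P (j + 1)) := by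
  filter_upwards [TOfPrint_one_le_ae_su2_record S hL hj (δ' := 1 / 3) (by norm_num)] with V hV
  exact hV.trans (density_third_le kstar_record_le _ _)

end Slot

end Summit.QuantumFields.YangMills.BalabanUVNodes.N08HaarCompatibilityGuardHaarBallLower

end
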